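import Mathlib.MeasureTheory.Integral.IntervalIntegral.FundThmCalculus
import Mathlib.MeasureTheory.Integral.DominatedConvergence
import Mathlib.Topology.MetricSpace.Thickening
import HarnessLib

/-!
# Conformal removability: the line lemma of Jones–Smirnov's Proposition 1

Support for the proof of `JonesSmirnov2000_frontier_of_isHolderDomain` (Jones–Smirnov 2000,
Cor. 2; `ConformalRemovability.lean`). Proposition 1 of P. W. Jones, S. K. Smirnov, Ark. Mat. 38
(2000), §2, pp. 270–273, proves that a continuous `f`, Sobolev off a compact `K`, is absolutely
continuous on almost every line `l`; its heart is the two-point estimate (10), p. 272: for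
`x, x' ∈ K ∩ l`,
`|f(x) - f(x')| ≤ ∫_{[x,x'] ∖ K} |∂f| + 2n Σ_{Q small, shadow(Q) ∩ [x,x'] ≠ ∅} |∇f|(Q) l(Q)`,
whose second term tends to `0` with the size of the Whitney cubes on almost every line (p. 273).
This file isolates the purely one-dimensional step FROM such an estimate TO the fundamental
theorem of calculus along the line, in the form consumed by the analytic definition of
holomorphy (`ConformalRemovabilityAnalytic.lean`):

* `sub_eq_integral_of_norm_sub_le_integral` — let `f : ℝ → E` be continuous on `[a, b]`,
  differentiable off a closed Lebesgue-null set `C` with an integrable derivative `f'`, and suppose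
  the TWO-POINT ESTIMATE `‖f x' - f x‖ ≤ ∫_x^{x'} ‖f'‖` for all `x ≤ x'` in `C ∩ [a, b]`. Then
  `f b - f a = ∫_a^b f'`.

The proof is a continuous induction on `[a, b]` (Mathlib's
`IsClosed.Icc_subset_of_forall_mem_nhdsWithin`) and replaces the appeal to the structure of
`BV`/`AC` functions in the paper: for `η > 0` let `O_η` be the open `η`-neighbourhood of `C` and
`g = f - ∫_a f'`; then `‖g x - g a‖ ≤ 2 ∫_{[a,x] ∩ O_η} ‖f'‖` propagates to the right — across a
`C`-free interval `g` is constant (fundamental theorem of calculus off `C`), and from a point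
`x ∈ C` one jumps to the last point `x*` of `C` before `x + η`, paying `2 ∫_x^{x*} ‖f'‖` inside
`O_η` by the two-point estimate. Letting `η → 0`, `∫_{[a,b] ∩ O_η} ‖f'‖ → ∫_{[a,b] ∩ C} ‖f'‖ = 0`.

## References

* [JonesSmirnov2000] P. W. Jones, S. K. Smirnov, *Removability theorems for Sobolev functions and
  quasiconformal maps*, Ark. Mat. 38 (2000) 263–279, §2, Prop. 1, estimates (8)–(11).
-/

noncomputable section

open Set Filter Metric MeasureTheory intervalIntegral
open scoped Topology

namespace Literature.Probability.RandomPlanarGeometry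

variable {E : Type*} [NormedAddCommGroup E] [NormedSpace ℝ E] [CompleteSpace E]

/-- **The line lemma (two-point estimate across a null closed set ⇒ fundamental theorem of
calculus).** Let `a ≤ b`, `C ⊆ ℝ` closed with Lebesgue measure `0`, `f : ℝ → E` continuous on
`[a, b]` with derivative `f' x` at every `x ∈ (a, b) ∖ C`, `f'` integrable on `[a, b]`, and assume
the two-point estimate `‖f x' - f x‖ ≤ ∫_x^{x'} ‖f'‖` for all `x ≤ x'` in `C ∩ [a, b]`
(Jones–Smirnov's (10)–(11) on a generic line, after the shadow term has been sent to `0`). Then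
`f b - f a = ∫_a^b f'`. This is the one-dimensional content of "Proposition 1 ⇒ `f` is ACL"
(Jones–Smirnov 2000, §2, pp. 270–273), proved here by continuous induction instead of the
decomposition of functions of bounded variation. [cite: JonesSmirnov2000, §2 Prop. 1 (8)–(11)] -/
theorem sub_eq_integral_of_norm_sub_le_integral {f f' : ℝ → E} {a b : ℝ} (hab : a ≤ b)
    {C : Set ℝ} (hC : IsClosed C) (hC0 : volume C = 0) (hfc : ContinuousOn f (Icc a b))
    (hfd : ∀ x ∈ Ioo a b \ C, HasDerivAt f (f' x) x) (hfi : IntervalIntegrable f' volume a b)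
    (h2 : ∀ x ∈ C ∩ Icc a b, ∀ x' ∈ C ∩ Icc a b, x ≤ x' →
      ‖f x' - f x‖ ≤ ∫ t in x..x', ‖f' t‖) :
    f b - f a = ∫ t in a..b, f' t := by
  -- integrability on subintervals
  have hsub : ∀ {h : ℝ → ℝ} , IntervalIntegrable h volume a b →
      ∀ p q, a ≤ p → p ≤ q → q ≤ b → IntervalIntegrable h volume p q :=
    fun hh p q hap hpq hqb => hh.mono_set (by
      rw [uIcc_of_le hab, uIcc_of_le hpq]; exact Icc_subset_Icc hap hqb)
  have hsubE : ∀ p q, a ≤ p → p ≤ q → q ≤ b → IntervalIntegrable f' volume p q :=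
    fun p q hap hpq hqb => hfi.mono_set (by
      rw [uIcc_of_le hab, uIcc_of_le hpq]; exact Icc_subset_Icc hap hqb)
  -- the defect `g = f - ∫_a f'`
  set g : ℝ → E := fun x => f x - ∫ t in a..x, f' t with hg
  suffices hgoal : g b = g a by
    simp only [hg, integral_same, sub_zero] at hgoal
    rw [← hgoal, sub_sub_cancel]
  -- across a `C`-free interval `g` is constant (fundamental theorem of calculus)
  have hgap : ∀ p q, a ≤ p → p ≤ q → q ≤ b → (∀ t ∈ Ioo p q, t ∉ C) → g q = g p := by
    intro p q hap hpq hqb hpqC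
    have hftc : ∫ t in p..q, f' t = f q - f p :=
      integral_eq_sub_of_hasDerivAt_of_le hpq (hfc.mono (Icc_subset_Icc hap hqb))
        (fun t ht => hfd t ⟨⟨lt_of_le_of_lt hap ht.1, lt_of_lt_of_le ht.2 hqb⟩, hpqC t ht⟩)
        (hsubE p q hap hpq hqb)
    have hsplit : (∫ t in a..q, f' t) - ∫ t in a..p, f' t = ∫ t in p..q, f' t :=
      integral_interval_sub_left (hsubE a q le_rfl (hap.trans hpq) hqb) (hsubE a p le_rfl hap
        (hpq.trans hqb))
    rw [hftc] at hsplit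
    simp only [hg]
    rw [sub_eq_sub_iff_sub_eq_sub]
    exact hsplit.symm
  -- continuity of `g` on `[a, b]`
  have hIcc : ∀ {h : ℝ → E}, IntervalIntegrable h volume a b → IntegrableOn h (uIcc a b) volume :=
    fun hh => by rw [uIcc_of_le hab]; exact (intervalIntegrable_iff_integrableOn_Icc_of_le hab).1 hh
  have hgc : ContinuousOn g (Icc a b) := by
    have := continuousOn_primitive_interval (hIcc hfi)
    rw [uIcc_of_le hab] at this
    exact hfc.sub this
  -- MAIN CLAIM: for every `η > 0`, `‖g b - g a‖ ≤ 2 ∫_{[a,b] ∩ O_η} ‖f'‖`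
  have hclaim : ∀ η : ℝ, 0 < η → ‖g b - g a‖ ≤
      2 * ∫ t in a..b, (thickening η C).indicator (fun t => ‖f' t‖) t := by
    intro η hη
    set O : Set ℝ := thickening η C with hO
    have hOm : MeasurableSet O := isOpen_thickening.measurableSet
    set φ : ℝ → ℝ := O.indicator fun t => ‖f' t‖ with hφ
    have hφ0 : ∀ t, 0 ≤ φ t := fun t => indicator_nonneg (fun _ _ => norm_nonneg _) t
    have hφi : IntervalIntegrable φ volume a b := ⟨hfi.norm.1.indicator hOm, hfi.norm.2.indicator hOm⟩
    have hsubφ : ∀ p q, a ≤ p → p ≤ q → q ≤ b → IntervalIntegrable φ volume p q :=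
      fun p q hap hpq hqb => hφi.mono_set (by
        rw [uIcc_of_le hab, uIcc_of_le hpq]; exact Icc_subset_Icc hap hqb)
    -- the budget `Φ x = ∫_a^x φ`
    set Φ : ℝ → ℝ := fun x => ∫ t in a..x, φ t with hΦ
    have hΦmono : ∀ x x', a ≤ x → x ≤ x' → x' ≤ b → Φ x ≤ Φ x' := fun x x' hax hxx' hx'b =>
      integral_mono_interval le_rfl hax hxx' (Eventually.of_forall fun t => hφ0 t)
        (hsubφ a x' le_rfl (hax.trans hxx') hx'b)
    have hΦsub : ∀ x x', a ≤ x → x ≤ x' → x' ≤ b → Φ x' - Φ x = ∫ t in x..x', φ t :=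
      fun x x' hax hxx' hx'b =>
        integral_interval_sub_left (hsubφ a x' le_rfl (hax.trans hxx') hx'b)
          (hsubφ a x le_rfl hax (hxx'.trans hx'b))
    have hΦc : ContinuousOn Φ (Icc a b) := by
      have hI : IntegrableOn φ (uIcc a b) volume := by
        rw [uIcc_of_le hab]; exact (intervalIntegrable_iff_integrableOn_Icc_of_le hab).1 hφi
      have := continuousOn_primitive_interval hI
      rwa [uIcc_of_le hab] at this
    -- continuous induction on `S = {x | ‖g x - g a‖ ≤ 2 Φ x}`
    set S : Set ℝ := {x | ‖g x - g a‖ ≤ 2 * Φ x} with hS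
    suffices hbS : b ∈ S from hbS
    refine (IsClosed.Icc_subset_of_forall_mem_nhdsWithin ?_ ?_ ?_) (right_mem_Icc.2 hab)
    · -- `S ∩ [a, b]` is closed
      have heq : S ∩ Icc a b =
          Icc a b ∩ (fun x => (‖g x - g a‖, 2 * Φ x)) ⁻¹' {p : ℝ × ℝ | p.1 ≤ p.2} := by
        ext x
        simp only [hS, mem_inter_iff, mem_setOf_eq, mem_preimage]
        tauto
      rw [heq]
      refine ContinuousOn.preimage_isClosed_of_isClosed ?_ isClosed_Icc isClosed_le_prod
      exact ((hgc.sub continuousOn_const).norm).prodMk (continuousOn_const.mul hΦc)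
    · -- `a ∈ S`
      simp [hS, hΦ]
    · -- propagation to the right of a point `x ∈ S ∩ [a, b)`
      rintro x ⟨hxS, hxa, hxb⟩
      have hxS' : ‖g x - g a‖ ≤ 2 * Φ x := hxS
      by_cases hxC : x ∈ C
      · -- `x ∈ C`: jump to the last point of `C` before `x''`, paying by the two-point estimate
        have hu : x < min (x + η) b := lt_min (by linarith) hxb
        refine mem_of_superset (Ioo_mem_nhdsGT hu) fun x'' hx'' => ?_
        obtain ⟨hxx'', hx''lt⟩ := hx''
        have hx''η : x'' < x + η := lt_of_lt_of_le hx''lt (min_le_left _ _)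
        have hx''b : x'' < b := lt_of_lt_of_le hx''lt (min_le_right _ _)
        have hD : IsCompact (C ∩ Icc x x'') := isCompact_Icc.inter_left hC
        have hxD : x ∈ C ∩ Icc x x'' := ⟨hxC, left_mem_Icc.2 hxx''.le⟩
        set x' : ℝ := sSup (C ∩ Icc x x'') with hx'
        have hx'D : x' ∈ C ∩ Icc x x'' := hD.sSup_mem ⟨x, hxD⟩
        have hxx' : x ≤ x' := hx'D.2.1
        have hx'x'' : x' ≤ x'' := hx'D.2.2
        have hfree : ∀ t ∈ Ioo x' x'', t ∉ C := fun t ht htC =>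
          (le_csSup hD.bddAbove ⟨htC, hxx'.trans ht.1.le, ht.2.le⟩).not_gt ht.1
        -- `g x'' = g x'`
        have hg1 : g x'' = g x' := hgap x' x'' (hxa.trans hxx') hx'x'' hx''b.le hfree
        -- `‖g x' - g x‖ ≤ 2 ∫_x^{x'} φ`
        have hg2 : ‖g x' - g x‖ ≤ 2 * ∫ t in x..x', φ t := by
          have hxI : x ∈ C ∩ Icc a b := ⟨hxC, hxa, hxb.le⟩
          have hx'I : x' ∈ C ∩ Icc a b := ⟨hx'D.1, hxa.trans hxx', hx'x''.trans hx''b.le⟩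
          have e1 : ‖f x' - f x‖ ≤ ∫ t in x..x', ‖f' t‖ := h2 x hxI x' hx'I hxx'
          have e2 : ‖(∫ t in a..x', f' t) - ∫ t in a..x, f' t‖ ≤ ∫ t in x..x', ‖f' t‖ := by
            rw [integral_interval_sub_left (hsubE a x' le_rfl (hxa.trans hxx')
              (hx'x''.trans hx''b.le)) (hsubE a x le_rfl hxa hxb.le)]
            exact norm_integral_le_integral_norm hxx'
          have e3 : ∫ t in x..x', ‖f' t‖ = ∫ t in x..x', φ t := by
            refine integral_congr fun t ht => ?_
            rw [uIcc_of_le hxx'] at ht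
            have htO : t ∈ O := mem_thickening_iff.2 ⟨x, hxC, by
              rw [Real.dist_eq, abs_of_nonneg (by linarith [ht.1])]
              linarith [ht.2]⟩
            simp [hφ, htO]
          calc ‖g x' - g x‖
              = ‖(f x' - f x) - ((∫ t in a..x', f' t) - ∫ t in a..x, f' t)‖ := by
                simp only [hg]; abel_nf
            _ ≤ ‖f x' - f x‖ + ‖(∫ t in a..x', f' t) - ∫ t in a..x, f' t‖ := norm_sub_le _ _
            _ ≤ (∫ t in x..x', ‖f' t‖) + ∫ t in x..x', ‖f' t‖ := add_le_add e1 e2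
            _ = 2 * ∫ t in x..x', φ t := by rw [e3]; ring
        have hΦ1 : Φ x' - Φ x = ∫ t in x..x', φ t :=
          hΦsub x x' hxa hxx' (hx'x''.trans hx''b.le)
        have hΦ2 : Φ x' ≤ Φ x'' := hΦmono x' x'' (hxa.trans hxx') hx'x'' hx''b.le
        show ‖g x'' - g a‖ ≤ 2 * Φ x''
        calc ‖g x'' - g a‖ = ‖(g x' - g x) + (g x - g a)‖ := by rw [hg1]; abel_nf
          _ ≤ ‖g x' - g x‖ + ‖g x - g a‖ := norm_add_le _ _
          _ ≤ 2 * (Φ x' - Φ x) + 2 * Φ x := by rw [hΦ1]; exact add_le_add hg2 hxS'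
          _ = 2 * Φ x' := by ring
          _ ≤ 2 * Φ x'' := by linarith
      · -- `x ∉ C`: `g` is constant just to the right of `x`
        obtain ⟨ρ, hρ, hρC⟩ : ∃ ρ > 0, ∀ t, dist t x < ρ → t ∉ C := by
          obtain ⟨ρ, hρ, hball⟩ := Metric.mem_nhds_iff.1 (hC.isOpen_compl.mem_nhds hxC)
          exact ⟨ρ, hρ, fun t ht => hball ht⟩
        have hu : x < min (x + ρ) b := lt_min (by linarith) hxb
        refine mem_of_superset (Ioo_mem_nhdsGT hu) fun x'' hx'' => ?_
        obtain ⟨hxx'', hx''lt⟩ := hx''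
        have hx''ρ : x'' < x + ρ := lt_of_lt_of_le hx''lt (min_le_left _ _)
        have hx''b : x'' < b := lt_of_lt_of_le hx''lt (min_le_right _ _)
        have hg1 : g x'' = g x := hgap x x'' hxa hxx''.le hx''b.le fun t ht => hρC t (by
          rw [Real.dist_eq, abs_of_nonneg (by linarith [ht.1])]
          linarith [ht.2])
        show ‖g x'' - g a‖ ≤ 2 * Φ x''
        rw [hg1]
        have := hΦmono x x'' hxa hxx''.le hx''b.le
        linarith
  -- letting `η = 1/(n+1) → 0`: `∫_{[a,b] ∩ O_η} ‖f'‖ → ∫_{[a,b] ∩ C} ‖f'‖ = 0`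
  have hlim : Tendsto (fun n : ℕ => ∫ t in a..b,
      (thickening (1 / ((n : ℝ) + 1)) C).indicator (fun t => ‖f' t‖) t) atTop (𝓝 0) := by
    set s : ℕ → Set ℝ := fun n => thickening (1 / ((n : ℝ) + 1)) C ∩ Ioc a b with hs
    have hsm : ∀ n, MeasurableSet (s n) := fun n =>
      isOpen_thickening.measurableSet.inter measurableSet_Ioc
    have hanti : Antitone s := by
      intro m n hmn
      refine inter_subset_inter_left _ (thickening_mono ?_ C)
      exact one_div_le_one_div_of_le (by positivity) (by exact_mod_cast Nat.add_le_add_right hmn 1)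
    have heq : ∀ n : ℕ, (∫ t in a..b, (thickening (1 / ((n : ℝ) + 1)) C).indicator
        (fun t => ‖f' t‖) t) = ∫ t in s n, ‖f' t‖ := fun n => by
      rw [integral_of_le hab, MeasureTheory.integral_indicator isOpen_thickening.measurableSet,
        Measure.restrict_restrict isOpen_thickening.measurableSet]
    simp_rw [heq]
    have hfi0 : IntegrableOn (fun t => ‖f' t‖) (s 0) volume :=
      (hfi.norm.1).mono_set inter_subset_right
    have ht := tendsto_setIntegral_of_antitone hsm hanti ⟨0, hfi0⟩
    have h0 : ∫ t in ⋂ n, s n, ‖f' t‖ = 0 := by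
      refine setIntegral_measure_zero _ (measure_mono_null ?_ hC0)
      intro x hx
      rw [mem_iInter] at hx
      rw [← hC.closure_eq, Metric.mem_closure_iff]
      intro ε hε
      obtain ⟨n, hn⟩ := exists_nat_one_div_lt hε
      obtain ⟨z, hzC, hz⟩ := mem_thickening_iff.1 (hx n).1
      exact ⟨z, hzC, hz.trans hn⟩
    rwa [h0] at ht
  have hle : ∀ n : ℕ, ‖g b - g a‖ ≤
      2 * ∫ t in a..b, (thickening (1 / ((n : ℝ) + 1)) C).indicator (fun t => ‖f' t‖) t :=
    fun n => hclaim _ Nat.one_div_pos_of_nat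
  have h0 := ge_of_tendsto' (hlim.const_mul 2) hle
  rw [mul_zero] at h0
  exact sub_eq_zero.1 (norm_le_zero_iff.1 h0)

end Literature.Probability.RandomPlanarGeometry
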